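import Literature.NumberTheory.Transcendental.NesterenkoElimination
import Literature.NumberTheory.Automorphic.ProjectiveElimination
import HarnessLib

/-!
# The zeros of the ideal `Ī(r)` (LNM 1752 Ch. 3 §4, Def. 4.3): hyperplanes through a point of `V(I)`

Topic `Literature/NumberTheory/Transcendental`. Proofs only (no named facts). For the objects of
`NesterenkoElimination.lean` (Nesterenko–Philippon (eds.), LNM 1752, Ch. 3 §4, Definition 4.3:
`Ī(r) = {G ∈ ℚ[U] : G xⱼ^M ∈ (I, L₁, …, L_r) ∀ j}`, `Lᵢ = ∑ⱼ u_{ij} xⱼ`) and a homogeneous ideal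
`I ⊂ ℚ[x₀, …, x_m]`, we prove the classical description of the zeros of `Ī(r)` over `ℂ`
("the associated form vanishes at `(u₁, …, u_r)` iff the hyperplanes `uᵢ · x = 0` have a
common point on `V(I)`"), in the two directions actually available from the definitions:

* `aeval_eq_zero_of_mem_elimIdeal` — if `β̄ ∈ V(I)` lies on all the hyperplanes
  `∑ⱼ u_{ij} xⱼ = 0` then `G(u) = 0` for every `G ∈ Ī(r)` (substitute `x̲ = β̄`, `U = u`).
* `exists_mem_elimIdeal_aeval_ne_zero` — conversely, if NO point of `V(I)` lies on all the
  hyperplanes `uᵢ`, then some `G ∈ Ī(r)` has `G(u) ≠ 0`; hence (`aeval_chowForm_eq_zero_iff`)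
  when `Ī(r) = (F)` is principal, `F(u) = 0 ↔ ∃ β̄ ∈ V(I), uᵢ · β̄ = 0 ∀ i`.

The second point is the main theorem of elimination theory for the family
`(generators of I, L₁, …, L_r)` over the parameter ring `ℚ[U]`, read off from the tree's
`Literature/NumberTheory/Automorphic/ProjectiveElimination.lean` (projective Nullstellensatz
`exists_ne_zero_common_zero_iff`; "all monomials of degree `D` lie in the ideal" is the
surjectivity of the Sylvester map `forall_monomial_mem_iff_surjective`; a surjective matrix has
an invertible maximal minor `mulVec_surjective_iff_exists_det_ne_zero`): the non-vanishing
maximal minor `G = det S` of the Sylvester matrix with entries in `ℚ[U]` satisfies, by the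
adjugate identity `S · adj S = det S`, `G · x^μ ∈ (I, L₁, …, L_r)` for every monomial `x^μ` of
degree `D`, i.e. `G ∈ Ī(r)`. This is the input of the proof of Proposition 4.13 (closest zero)
in `NesterenkoEliminationProp413Proofs.lean`.

## References

* [NesterenkoPhilippon2001] Yu. V. Nesterenko, P. Philippon (eds.), *Introduction to Algebraic
  Independence Theory*, LNM 1752, Springer 2001, Ch. 3 §4, Def. 4.3, Prop. 4.4 (p. 38).
* I. R. Shafarevich, *Basic Algebraic Geometry 1*, I.5.2 (main theorem of elimination theory).
-/

noncomputable section

open MvPolynomial Literature.NumberTheory.Automorphic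


namespace Literature.NumberTheory.Transcendental

namespace Nesterenko

variable {m : ℕ}

/-! ### The easy direction: `Ī(r)` vanishes on hyperplanes through a point of `V(I)` -/

/-- If `β̄ ∈ V(I)` and `∑ⱼ u_{ij} βⱼ = 0` for all `i`, then `G(u) = 0` for every `G ∈ Ī(r)`:
substituting `x̲ = β̄`, `U = u` in `G xⱼ^M ∈ (I, L₁, …, L_r)` kills the right-hand side.
[cite: NesterenkoPhilippon2001, Ch. 3 Def. 4.3 (p. 38)] -/
theorem aeval_eq_zero_of_mem_elimIdeal {r : ℕ} {I : Ideal (Rx m)} {G : RU r m}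
    (hG : G ∈ elimIdeal I r) {β : Fin (m + 1) → ℂ} (hβ : β ∈ projZeros I)
    {u : Fin r × Fin (m + 1) → ℂ} (hu : ∀ i : Fin r, ∑ j : Fin (m + 1), u (i, j) * β j = 0) :
    aeval u G = 0 := by
  obtain ⟨M, -, hM⟩ := hG
  obtain ⟨hβ0, hβI⟩ := hβ
  obtain ⟨j, hj⟩ := Function.ne_iff.mp hβ0
  set ev : RUX r m →ₐ[ℚ] ℂ := aeval (Sum.elim u β) with hev
  have ev_inl : ∀ G : RU r m, ev (rename Sum.inl G) = aeval u G := fun G => by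
    rw [hev, aeval_rename]; rfl
  have ev_inr : ∀ P : Rx m, ev (rename Sum.inr P) = aeval β P := fun P => by
    rw [hev, aeval_rename]; rfl
  have ev_L : ∀ i, ev (linForm r m i) = 0 := fun i => by
    simp only [hev, linForm, map_sum, map_mul, aeval_X, Sum.elim_inl, Sum.elim_inr]
    exact hu i
  have hker : extIdeal I r ≤ RingHom.ker ev := by
    refine sup_le ?_ ?_
    · rw [Ideal.map_le_iff_le_comap]
      intro P hP
      rw [Ideal.mem_comap, RingHom.mem_ker, ev_inr, hβI P hP]
    · rw [Ideal.span_le]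
      rintro _ ⟨i, rfl⟩
      exact ev_L i
  have h := hker (hM j)
  rw [RingHom.mem_ker, map_mul, map_pow, ev_inl, hev, aeval_X, Sum.elim_inr] at h
  exact (mul_eq_zero.mp h).resolve_right (pow_ne_zero _ hj)

/-! ### Homogeneous ideals have finite homogeneous generating families -/

/-- A homogeneous ideal of `ℚ[x₀, …, x_m]` is generated by finitely many homogeneous polynomials
(the homogeneous components of a finite generating set). [folklore] -/
theorem exists_homogeneous_generators {I : Ideal (Rx m)}
    (hI : letI := MvPolynomial.gradedAlgebra (σ := Fin (m + 1)) (R := ℚ)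
      I.IsHomogeneous (homogeneousSubmodule (Fin (m + 1)) ℚ)) :
    ∃ (n : ℕ) (g : Fin n → Rx m) (d : Fin n → ℕ),
      (∀ j, (g j).IsHomogeneous (d j)) ∧ Ideal.span (Set.range g) = I := by
  classical
  obtain ⟨s, hs⟩ := (IsNoetherian.noetherian I : I.FG)
  -- the finite set of pairs (generator, degree)
  set T : Finset (Rx m × ℕ) := s.biUnion fun p => (Finset.range (p.totalDegree + 1)).image
    fun e => (p, e) with hT
  set n := T.card
  set e : Fin n ≃ T := (T.equivFin).symm
  refine ⟨n, fun j => homogeneousComponent (e j).1.2 (e j).1.1, fun j => (e j).1.2,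
    fun j => homogeneousComponent_isHomogeneous _ _, le_antisymm ?_ ?_⟩
  · rw [Ideal.span_le]
    rintro _ ⟨j, rfl⟩
    have hmem : (e j).1 ∈ s.biUnion fun p => (Finset.range (p.totalDegree + 1)).image
        fun e => (p, e) := (e j).2
    rw [Finset.mem_biUnion] at hmem
    obtain ⟨p, hp, hpe⟩ := hmem
    rw [Finset.mem_image] at hpe
    obtain ⟨k, -, hk⟩ := hpe
    have hpI : p ∈ I := by rw [← hs]; exact Ideal.subset_span hp
    show homogeneousComponent (e j).1.2 (e j).1.1 ∈ I
    have h1 : (e j).1.1 = p := by rw [← hk]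
    have h2 : (e j).1.2 = k := by rw [← hk]
    rw [h1, h2]
    exact homogeneousComponent_mem_of_mem hI hpI k
  · rw [← hs, Ideal.span_le]
    intro p hp
    rw [SetLike.mem_coe, ← sum_homogeneousComponent p]
    refine Ideal.sum_mem _ fun k hk => ?_
    have hpk : (p, k) ∈ T := by
      rw [hT, Finset.mem_biUnion]
      exact ⟨p, hp, Finset.mem_image.mpr ⟨k, hk, rfl⟩⟩
    have : homogeneousComponent k p = homogeneousComponent (e (e.symm ⟨(p, k), hpk⟩)).1.2
        (e (e.symm ⟨(p, k), hpk⟩)).1.1 := by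
      rw [Equiv.apply_symm_apply]
    rw [this]
    exact Ideal.subset_span ⟨e.symm ⟨(p, k), hpk⟩, rfl⟩

/-! ### The rings `ℚ[U, x̲] ≃ ℚ[U][x̲]` and the membership criterion for `Ī(r)` -/

section Family

variable {r : ℕ}

/-- The algebra isomorphism `ℚ[U, x̲] ≃ ℚ[U][x̲]` (`u_{ij} ↦ u_{ij}`, `xⱼ ↦ xⱼ`) exists
(Mathlib's `sumAlgEquiv` after swapping the two groups of variables). [folklore] -/
theorem exists_algEquiv_RUX (r m : ℕ) :
    ∃ τ : RUX r m ≃ₐ[ℚ] MvPolynomial (Fin (m + 1)) (RU r m),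
      (∀ v, τ (X (Sum.inl v)) = C (X v)) ∧ ∀ j, τ (X (Sum.inr j)) = X j :=
  ⟨(renameEquiv ℚ (Equiv.sumComm (Fin r × Fin (m + 1)) (Fin (m + 1)))).trans
      (sumAlgEquiv ℚ (Fin (m + 1)) (Fin r × Fin (m + 1))),
    fun v => by simp [sumAlgEquiv_X_inr], fun j => by simp [sumAlgEquiv_X_inl]⟩

variable {τ : RUX r m ≃ₐ[ℚ] MvPolynomial (Fin (m + 1)) (RU r m)}

/-- Such an isomorphism sends `G ∈ ℚ[U]` to the constant `G`. [folklore] -/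
theorem algEquiv_rename_inl (hτl : ∀ v, τ (X (Sum.inl v)) = C (X v)) (G : RU r m) :
    τ (rename Sum.inl G) = C G := by
  induction G using MvPolynomial.induction_on with
  | C a =>
    rw [rename_C, show (C a : RUX r m) = algebraMap ℚ (RUX r m) a from rfl, AlgEquiv.commutes]
    simp [MvPolynomial.algebraMap_apply, MvPolynomial.algebraMap_eq]
  | add p q hp hq => rw [map_add, map_add, hp, hq, map_add]
  | mul_X p v hp => rw [map_mul, map_mul, hp, rename_X, hτl, map_mul]

/-- … and `P ∈ ℚ[x̲]` to `P` with constant coefficients. [folklore] -/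
theorem algEquiv_rename_inr (hτr : ∀ j, τ (X (Sum.inr j)) = X j) (P : Rx m) :
    τ (rename Sum.inr P) = map (algebraMap ℚ (RU r m)) P := by
  induction P using MvPolynomial.induction_on with
  | C a =>
    rw [rename_C, show (C a : RUX r m) = algebraMap ℚ (RUX r m) a from rfl, AlgEquiv.commutes,
      map_C]
    simp [MvPolynomial.algebraMap_apply, MvPolynomial.algebraMap_eq]
  | add p q hp hq => rw [map_add, map_add, hp, hq, map_add]
  | mul_X p v hp => rw [map_mul, map_mul, hp, rename_X, hτr, map_mul, map_X]

/-- … and `Lᵢ` to the linear form `∑ⱼ u_{ij} xⱼ` with coefficients `u_{ij} ∈ ℚ[U]`. [folklore] -/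
theorem algEquiv_linForm (hτl : ∀ v, τ (X (Sum.inl v)) = C (X v))
    (hτr : ∀ j, τ (X (Sum.inr j)) = X j) (i : Fin r) :
    τ (linForm r m i) = ∑ j : Fin (m + 1), C (X (i, j)) * X j := by
  simp only [linForm, map_sum, map_mul, hτl, hτr]

/-- **Membership criterion for `Ī(r)` read in `ℚ[U][x̲]`**: if a family `f` consists of images
of elements of `(I, L₁, …, L_r)` and `G xⱼ^D ∈ (f)` for all `j` (`D > 0`), then `G ∈ Ī(r)`.
[cite: NesterenkoPhilippon2001, Ch. 3 Def. 4.3 (p. 38)] -/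
theorem mem_elimIdeal_of_forall_C_mul_X_pow_mem (hτl : ∀ v, τ (X (Sum.inl v)) = C (X v))
    (hτr : ∀ j, τ (X (Sum.inr j)) = X j) {I : Ideal (Rx m)} {k : ℕ}
    {f : Fin k → MvPolynomial (Fin (m + 1)) (RU r m)} (hf : ∀ c, ∃ y ∈ extIdeal I r, τ y = f c)
    {G : RU r m} {D : ℕ} (hD : 0 < D)
    (h : ∀ j : Fin (m + 1), C G * X j ^ D ∈ Ideal.span (Set.range f)) :
    G ∈ elimIdeal I r := by
  have hle : Ideal.span (Set.range f) ≤ Ideal.map τ (extIdeal I r) := by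
    rw [Ideal.span_le]
    rintro _ ⟨c, rfl⟩
    obtain ⟨y, hy, hyc⟩ := hf c
    rw [SetLike.mem_coe, ← hyc]
    exact Ideal.mem_map_of_mem _ hy
  refine ⟨D, hD, fun j => ?_⟩
  have h1 := hle (h j)
  have e : C G * X j ^ D = τ (rename Sum.inl G * X (Sum.inr j) ^ D) := by
    rw [map_mul, map_pow, algEquiv_rename_inl hτl, hτr]
  rw [e] at h1
  exact (Ideal.apply_mem_of_equiv_iff (f := τ.toRingEquiv)).mp h1

/-- The Sylvester matrix of a specialised family `ψ(f)` (`ψ : ℚ[U] → ℂ`) is the specialisation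
of the Sylvester matrix with entries in `ℚ[U]`. [folklore] -/
theorem sylvesterMatrix_map_family {k : ℕ} (f : Fin k → MvPolynomial (Fin (m + 1)) (RU r m))
    (d : Fin k → ℕ) (D : ℕ) (ψ : RU r m →+* ℂ) :
    sylvesterMatrix (fun c => map ψ (f c)) d D = (sylvesterMatrixPoly f d D).map ψ := by
  ext s c
  rw [sylvesterMatrix_apply, Matrix.map_apply, sylvesterMatrixPoly]
  split_ifs with h
  · rw [coeff_map]
  · rw [map_zero]

/-- Monomials: if all monomials of degree `D` lie in an ideal, so do all monomials of degree
`D + 1`. [folklore] -/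
theorem forall_monomial_mem_succ {R : Type*} [CommSemiring R] {σ : Type*}
    {J : Ideal (MvPolynomial σ R)} {D : ℕ}
    (h : ∀ s : σ →₀ ℕ, s.degree = D → monomial s (1 : R) ∈ J) (s : σ →₀ ℕ)
    (hs : s.degree = D + 1) : monomial s (1 : R) ∈ J := by
  classical
  obtain ⟨i, hi⟩ : ∃ i, s i ≠ 0 := by
    by_contra hcon
    push Not at hcon
    have : s = 0 := Finsupp.ext hcon
    rw [this, map_zero] at hs
    omega
  have hs' : s = (s - Finsupp.single i 1) + Finsupp.single i 1 := by
    ext j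
    rw [Finsupp.add_apply, Finsupp.tsub_apply, Finsupp.single_apply]
    split_ifs with hij
    · subst hij; omega
    · omega
  have hdeg : (s - Finsupp.single i 1).degree = D := by
    have h1 := congrArg Finsupp.degree hs'
    rw [map_add, Finsupp.degree_single, hs] at h1
    omega
  have e1 : monomial s (1 : R) = monomial (s - Finsupp.single i 1) (1 : R) * X i := by
    rw [X, monomial_mul, mul_one, ← hs']
  rw [e1]
  exact J.mul_mem_right _ (h _ hdeg)

/-! ### The adjugate identity in `ℚ[U][x̲]` -/

/-- Coefficients of `x^t · f`: the entries of `sylvesterMatrixPoly`. [folklore] -/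
theorem coeff_monomial_one_mul {R : Type*} [CommSemiring R] {σ : Type*} (s t : σ →₀ ℕ)
    (f : MvPolynomial σ R) :
    coeff s (monomial t (1 : R) * f) = if t ≤ s then coeff (s - t) f else 0 := by
  classical
  rw [coeff_monomial_mul', one_mul]

/-- A homogeneous polynomial over any commutative semiring whose coefficients on the monomials of
its degree are those of `monomial s₀ a` is `monomial s₀ a`. [folklore] -/
theorem eq_monomial_of_coeff {R : Type*} [CommSemiring R] {σ : Type*} {P : MvPolynomial σ R}
    {D : ℕ} (hP : P.IsHomogeneous D) {s₀ : σ →₀ ℕ} (hs₀ : s₀.degree = D) {a : R}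
    (h₁ : coeff s₀ P = a) (h₂ : ∀ s : σ →₀ ℕ, s.degree = D → s ≠ s₀ → coeff s P = 0) :
    P = monomial s₀ a := by
  classical
  ext s
  rw [coeff_monomial]
  by_cases hs : s.degree = D
  · by_cases hss : s = s₀
    · subst hss; simp [h₁]
    · rw [h₂ s hs hss, if_neg (Ne.symm hss)]
  · rw [hP.coeff_eq_zero hs, if_neg]
    rintro rfl
    exact hs hs₀

/-- **The adjugate step.** Let `S` be a square submatrix (all rows, columns `J`) of the Sylvester
matrix of a homogeneous family `f` over a commutative ring `A`, `G = det S`. Then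
`G · x^{s₀} ∈ (f)` for every monomial `x^{s₀}` of degree `D`. [folklore] -/
theorem C_det_mul_monomial_mem_span {k' : ℕ} {f : Fin k' → MvPolynomial (Fin (m + 1)) (RU r m)}
    {d : Fin k' → ℕ} (hf : ∀ c, (f c).IsHomogeneous (d c)) (D : ℕ)
    (J : Exps (Fin (m + 1)) D → SylCols (Fin (m + 1)) d D) (s₀ : Exps (Fin (m + 1)) D) :
    C ((sylvesterMatrixPoly f d D).submatrix id J).det * monomial s₀.1 (1 : RU r m) ∈
      Ideal.span (Set.range f) := by
  classical
  set M := sylvesterMatrixPoly f d D with hMdef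
  set S := M.submatrix id J with hS
  set adj := S.adjugate with hadj
  -- the combination `P = ∑_{s'} adj_{s' s₀} · x^{t(J s')} f_{j(J s')}`
  set P : MvPolynomial (Fin (m + 1)) (RU r m) :=
    ∑ s' : Exps (Fin (m + 1)) D, C (adj s' s₀) * (monomial (J s').2.1 (1 : RU r m) * f (J s').1.1)
    with hP
  have hPmem : P ∈ Ideal.span (Set.range f) := by
    refine Ideal.sum_mem _ fun s' _ => ?_
    rw [← mul_assoc]
    exact Ideal.mul_mem_left _ _ (Ideal.subset_span ⟨(J s').1.1, rfl⟩)
  have hPhom : P.IsHomogeneous D := by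
    refine IsHomogeneous.sum _ _ _ fun s' _ => ?_
    have h1 : (monomial (J s').2.1 (1 : RU r m) * f (J s').1.1).IsHomogeneous
        (D - d (J s').1.1 + d (J s').1.1) :=
      (isHomogeneous_monomial _ (J s').2.2).mul (hf (J s').1.1)
    rw [Nat.sub_add_cancel (J s').1.2] at h1
    exact h1.C_mul _
  -- its coefficients are `det S · δ_{s s₀}`
  have hcoeff : ∀ s : Fin (m + 1) →₀ ℕ, ∀ hs : s.degree = D,
      coeff s P = if (⟨s, hs⟩ : Exps (Fin (m + 1)) D) = s₀ then S.det else 0 := by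
    intro s hs
    have e1 : coeff s P = ∑ s' : Exps (Fin (m + 1)) D, S ⟨s, hs⟩ s' * adj s' s₀ := by
      rw [hP, coeff_sum]
      refine Finset.sum_congr rfl fun s' _ => ?_
      rw [coeff_C_mul, coeff_monomial_one_mul, mul_comm]
      rfl
    rw [e1, ← Matrix.mul_apply, hadj, Matrix.mul_adjugate, Matrix.smul_apply, Matrix.one_apply,
      smul_eq_mul, mul_ite, mul_one, mul_zero]
  have hPeq : P = monomial s₀.1 S.det := by
    refine eq_monomial_of_coeff hPhom s₀.2 ?_ fun s hs hss => ?_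
    · rw [hcoeff s₀.1 s₀.2, if_pos rfl]
    · rw [hcoeff s hs, if_neg (fun h' => hss (congrArg Subtype.val h'))]
  have e2 : C S.det * monomial s₀.1 (1 : RU r m) = monomial s₀.1 S.det := by
    rw [C_mul_monomial, mul_one]
  rw [e2, ← hPeq]
  exact hPmem

end Family

/-! ### The hard direction -/

/-- **Zeros of `Ī(r)`, hard direction.** Let `I ⊂ ℚ[x₀, …, x_m]` be a homogeneous ideal and
`u = (u₁, …, u_r) ∈ ℂ^{r(m+1)}`. If no point of `V(I) ⊂ P^m(ℂ)` lies on all the hyperplanes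
`∑ⱼ u_{ij} xⱼ = 0`, then some `G ∈ Ī(r)` does not vanish at `u`. (Main theorem of elimination
theory for the family `(I, L₁, …, L_r)` over `ℚ[U]`, via the Sylvester matrix.)
[cite: NesterenkoPhilippon2001, Ch. 3 Def. 4.3, Prop. 4.4 (p. 38)] -/
theorem exists_mem_elimIdeal_aeval_ne_zero {r : ℕ} {I : Ideal (Rx m)}
    (hI : letI := MvPolynomial.gradedAlgebra (σ := Fin (m + 1)) (R := ℚ)
      I.IsHomogeneous (homogeneousSubmodule (Fin (m + 1)) ℚ))
    (u : Fin r × Fin (m + 1) → ℂ)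
    (hu : ∀ β ∈ projZeros I, ∃ i : Fin r, ∑ j : Fin (m + 1), u (i, j) * β j ≠ 0) :
    ∃ G ∈ elimIdeal I r, aeval u G ≠ 0 := by
  classical
  obtain ⟨n, g, d, hg, hspan⟩ := exists_homogeneous_generators hI
  have hgI : ∀ j, g j ∈ I := fun j => by rw [← hspan]; exact Ideal.subset_span ⟨j, rfl⟩
  obtain ⟨τ, hτl, hτr⟩ := exists_algEquiv_RUX r m
  -- the family `(g₁, …, g_n, L₁, …, L_r)` in `ℚ[U][x̲]` and its degrees
  set f : Fin (n + r) → MvPolynomial (Fin (m + 1)) (RU r m) :=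
    Fin.append (fun j => map (algebraMap ℚ (RU r m)) (g j))
      (fun i => ∑ j : Fin (m + 1), C (X (i, j)) * X j) with hfdef
  set df : Fin (n + r) → ℕ := Fin.append d (fun _ => 1) with hdfdef
  have hf_left : ∀ j, f (Fin.castAdd r j) = map (algebraMap ℚ (RU r m)) (g j) := fun j => by
    simp [hfdef]
  have hf_right : ∀ i, f (Fin.natAdd n i) = ∑ j : Fin (m + 1), C (X (i, j)) * X j := fun i => by
    simp [hfdef]
  have hdf_left : ∀ j, df (Fin.castAdd r j) = d j := fun j => by simp [hdfdef]
  have hdf_right : ∀ i, df (Fin.natAdd n i) = 1 := fun i => by simp [hdfdef]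
  have hfhom : ∀ c, (f c).IsHomogeneous (df c) := by
    refine Fin.addCases (fun j => ?_) (fun i => ?_)
    · rw [hf_left, hdf_left]
      exact (hg j).map _
    · rw [hf_right, hdf_right]
      exact IsHomogeneous.sum _ _ _ fun j _ => (isHomogeneous_X _ j).C_mul _
  have hfext : ∀ c, ∃ y ∈ extIdeal I r, τ y = f c := by
    refine Fin.addCases (fun j => ?_) (fun i => ?_)
    · exact ⟨rename Sum.inr (g j), Ideal.mem_sup_left (Ideal.mem_map_of_mem _ (hgI j)),
        by rw [algEquiv_rename_inr hτr, hf_left]⟩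
    · exact ⟨linForm r m i, Ideal.mem_sup_right (Ideal.subset_span ⟨i, rfl⟩),
        by rw [algEquiv_linForm hτl hτr, hf_right]⟩
  -- the specialised family `(g₁, …, g_n, u₁ · x, …, u_r · x) ⊂ ℂ[x̲]`
  set ψ : RU r m →+* ℂ := (aeval u).toRingHom with hψ
  have hψ_apply : ∀ G : RU r m, ψ G = aeval u G := fun G => rfl
  set fs : Fin (n + r) → MvPolynomial (Fin (m + 1)) ℂ := fun c => map ψ (f c) with hfs
  have hfs_left : ∀ j, fs (Fin.castAdd r j) = map (algebraMap ℚ ℂ) (g j) := fun j => by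
    have h : ψ.comp (algebraMap ℚ (RU r m)) = algebraMap ℚ ℂ := Subsingleton.elim _ _
    show map ψ (f (Fin.castAdd r j)) = _
    rw [hf_left, map_map, h]
  have hfs_right : ∀ i, fs (Fin.natAdd n i) = ∑ j : Fin (m + 1), C (u (i, j)) * X j := fun i => by
    show map ψ (f (Fin.natAdd n i)) = _
    rw [hf_right, map_sum]
    refine Finset.sum_congr rfl fun j _ => ?_
    rw [map_mul, map_C, map_X, hψ_apply, aeval_X]
  have hfshom : ∀ c, (fs c).IsHomogeneous (df c) := fun c => (hfhom c).map _
  -- it has no common zero `x ≠ 0`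
  have hno : ¬ ∃ x : Fin (m + 1) → ℂ, x ≠ 0 ∧ ∀ c, eval x (fs c) = 0 := by
    rintro ⟨x, hx0, hx⟩
    have hxV : x ∈ projZeros I := by
      refine ⟨hx0, fun P hP => ?_⟩
      rw [← hspan] at hP
      have hgen : ∀ j, aeval x (g j) = 0 := fun j => by
        have := hx (Fin.castAdd r j)
        rwa [hfs_left, eval_map, ← aeval_def] at this
      rw [← RingHom.mem_ker]
      refine (Ideal.span_le.mpr ?_) hP
      rintro _ ⟨j, rfl⟩
      exact (RingHom.mem_ker).mpr (hgen j)
    obtain ⟨i, hi⟩ := hu x hxV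
    have := hx (Fin.natAdd n i)
    rw [hfs_right, map_sum] at this
    exact hi (by simpa [eval_C, eval_X] using this)
  rw [exists_ne_zero_common_zero_iff] at hno
  push Not at hno
  obtain ⟨D₀, hD₀⟩ := hno
  -- all monomials of degree `D = D₀ + 1 ≥ 1` lie in the specialised ideal: a maximal minor
  set D := D₀ + 1 with hDdef
  have hD : ∀ s : Fin (m + 1) →₀ ℕ, s.degree = D →
      monomial s (1 : ℂ) ∈ Ideal.span (Set.range fs) :=
    forall_monomial_mem_succ hD₀
  rw [forall_monomial_mem_iff_surjective hfshom D, mulVec_surjective_iff_exists_det_ne_zero] at hD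
  obtain ⟨J, hJ⟩ := hD
  rw [hfs, sylvesterMatrix_map_family f df D ψ, Matrix.submatrix_map, ← RingHom.mapMatrix_apply,
    ← RingHom.map_det] at hJ
  refine ⟨((sylvesterMatrixPoly f df D).submatrix id J).det, ?_, hJ⟩
  refine mem_elimIdeal_of_forall_C_mul_X_pow_mem hτl hτr hfext (Nat.succ_pos D₀) fun j => ?_
  have hdeg : (Finsupp.single j D : Fin (m + 1) →₀ ℕ).degree = D := by
    simp [Finsupp.degree_single]
  have := C_det_mul_monomial_mem_span hfhom D J ⟨Finsupp.single j D, hdeg⟩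
  rwa [X_pow_eq_monomial]

/-- **Zeros of the associated form.** If `Ī(r) = (F)` is principal (`F = chowForm I r`), then for
`u ∈ ℂ^{r(m+1)}`: `F(u) = 0` iff some `β̄ ∈ V(I)` lies on all the hyperplanes `uᵢ · x = 0`.
[cite: NesterenkoPhilippon2001, Ch. 3 Prop. 4.4 (p. 38)] -/
theorem aeval_chowForm_eq_zero_iff {r : ℕ} {I : Ideal (Rx m)}
    (hI : letI := MvPolynomial.gradedAlgebra (σ := Fin (m + 1)) (R := ℚ)
      I.IsHomogeneous (homogeneousSubmodule (Fin (m + 1)) ℚ))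
    (hpr : (elimIdeal I r).IsPrincipal) (u : Fin r × Fin (m + 1) → ℂ) :
    aeval u (chowForm I r) = 0 ↔
      ∃ β ∈ projZeros I, ∀ i : Fin r, ∑ j : Fin (m + 1), u (i, j) * β j = 0 := by
  constructor
  · intro h
    by_contra hne
    push Not at hne
    obtain ⟨G, hG, hGu⟩ := exists_mem_elimIdeal_aeval_ne_zero hI u hne
    rw [← span_chowForm I r hpr, Ideal.mem_span_singleton] at hG
    obtain ⟨H, rfl⟩ := hG
    rw [map_mul, h, zero_mul] at hGu
    exact hGu rfl
  · rintro ⟨β, hβ, hu⟩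
    have hF : chowForm I r ∈ elimIdeal I r := by
      rw [← span_chowForm I r hpr]
      exact Ideal.mem_span_singleton_self _
    exact aeval_eq_zero_of_mem_elimIdeal hF hβ hu

end Nesterenko

end Literature.NumberTheory.Transcendental

end
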